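import Mathlib.Algebra.Order.BigOperators.Group.Finset
import Literature.Probability.LatticeModels.PercolationRowEdgeOperators
import HarnessLib

/-!
# Planar (non-crossing) row connectivity states

Companion to `PercolationRowTransfer.lean` (item (1) of the definition request
`PercolationRowTransfer`, route `CriticalPhenomena/CardyPolygonWords`): the state space `V_S` of the
connectivity-state transfer matrix consists of the set partitions of the row points `S ⊔ {⋆}`
that are realisable by disjoint connections drawn in the region swept so far (below the row, `⋆`
being its bottom boundary arc) — the "planar (Catalan-like) connectivities" of Jacobsen–Zinn-Justin
(arXiv:cond-mat/0111374, §4), the link patterns / "non-intersecting half-loops" of the loop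
formulation (Pearce–Rittenberg–de Gier–Nienhuis 2002, §2; Bondesan–Jacobsen–Saleur
arXiv:1207.7005, §5). Going once around the boundary of that region (the row on top, the arc `⋆`
below it) meets the columns in increasing order and then `⋆`, so realisability is the classical
NON-CROSSING condition for set partitions of this cyclically (here: linearly, `⋆` last) ordered
set: there are no `a < b < c < d` with `a ~ c`, `b ~ d` in two different classes (Kreweras 1972,
non-crossing partitions of a cycle; folklore).

* `RowPoint.pos` — the boundary position (a column at its abscissa, `⋆` at `starPos S`, to the
  right of every column); `IsNonCrossing π`; `RowState.IsPlanar`.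
* Planarity is preserved by every letter of the transfer-matrix words: the vertical layer / detach
  generators (`IsNonCrossing.vertRel`), the join generator of an edge `{x, x + 1}` — merging the
  classes of two ADJACENT boundary points keeps a partition non-crossing (`IsNonCrossing.joinRel`,
  via the interval lemma `IsNonCrossing.mem_Ioo_of_rel`) — hence `horizRel`, `rowStep`
  (`RowState.IsPlanar.rowStep`), and the junction maps (`IsNonCrossing.insertRel`,
  `IsNonCrossing.restrictRel`); the wired and free states are planar.
* `PlanarRowState S` — the finite type `V_S` of planar states (with the wired state), the
  restricted dynamics `planarRowStep`, and **`planarTransfer S`**, the transfer matrix on `V_S`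
  (the principal submatrix of `PercolationRowTransfer S`), which is again stochastic
  (`sum_planarTransfer_eq_one`: no mass leaves `V_S`), with `planarBoundary` / `planarReadout`.

Not here: the count `|V_S| = Catalan(|S| + 1)`, and the converse "every planar state is reachable
from the wired one".
-/

noncomputable section

open Finset
open scoped BigOperators Classical

namespace Literature.Probability.LatticeModels

variable {S S' : Finset ℤ}

/-! ### Boundary positions -/

/-- The boundary position of `⋆`: an integer to the right of every column of `S`. [folklore] -/
def starPos (S : Finset ℤ) : ℤ := 1 + ∑ x ∈ S, |x|

/-- Every column lies strictly to the left of `starPos S`. [folklore] -/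
theorem lt_starPos {x : ℤ} (hx : x ∈ S) : x < starPos S := by
  have h1 : x ≤ |x| := le_abs_self x
  have h2 : |x| ≤ ∑ y ∈ S, |y| := Finset.single_le_sum (fun y _ => abs_nonneg y) hx
  unfold starPos
  omega

/-- **Boundary position of a row point**: reading the boundary of the region below the row
counter-clockwise, the columns come in increasing order and `⋆` (the bottom arc) after all of them.
[cite: JacobsenZinnjustin2001, §4] -/
def RowPoint.pos : RowPoint S → ℤ
  | Sum.inl x => x
  | Sum.inr _ => starPos S

/-- A column sits at its abscissa. [folklore] -/
@[simp] theorem RowPoint.pos_inl (x : S) : RowPoint.pos (Sum.inl x : RowPoint S) = x := rfl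

/-- `⋆` sits at `starPos S`. [folklore] -/
@[simp] theorem RowPoint.pos_inr (u : Unit) : RowPoint.pos (Sum.inr u : RowPoint S) = starPos S := rfl

/-- Distinct row points have distinct boundary positions. [folklore] -/
theorem RowPoint.pos_injective : Function.Injective (RowPoint.pos (S := S)) := by
  rintro (x | u) (y | v) h
  · simp only [RowPoint.pos_inl] at h
    exact congrArg Sum.inl (Subtype.ext h)
  · simp only [RowPoint.pos_inl, RowPoint.pos_inr] at h
    exact absurd h (lt_starPos x.2).ne
  · simp only [RowPoint.pos_inl, RowPoint.pos_inr] at h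
    exact absurd h.symm (lt_starPos y.2).ne
  · rfl

/-! ### Non-crossing partitions of the row points -/

/-- **Non-crossing (planar) partition of the row points**: there are no boundary positions
`a < b < c < d` with `a ~ c` and `b ~ d` unless all four are in one class — the partitions
realisable by disjoint connections inside a disc whose boundary carries the points in this cyclic
order ("planar (Catalan-like) connectivities"). [cite: JacobsenZinnjustin2001, §4] -/
def IsNonCrossing (π : Setoid (RowPoint S)) : Prop :=
  ∀ a b c d : RowPoint S, a.pos < b.pos → b.pos < c.pos → c.pos < d.pos → π a c → π b d → π a b

/-- The wired partition is non-crossing. [folklore] -/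
theorem isNonCrossing_top : IsNonCrossing (⊤ : Setoid (RowPoint S)) :=
  fun _ _ _ _ _ _ _ _ _ => trivial

/-- The totally disconnected partition is non-crossing. [folklore] -/
theorem isNonCrossing_bot : IsNonCrossing (⊥ : Setoid (RowPoint S)) := by
  intro a b c d _ _ hcd hac _
  have hac' : a = c := hac
  subst hac'
  omega

namespace IsNonCrossing

variable {π : Setoid (RowPoint S)}

/-- **Interval lemma.** In a non-crossing partition, if `a < b < c`, `a ~ c` and `b ≁ a`, then the
whole class of `b` lies strictly between `a` and `c`. [folklore] -/
theorem mem_Ioo_of_rel (hπ : IsNonCrossing π) {a b c w : RowPoint S} (hab : a.pos < b.pos)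
    (hbc : b.pos < c.pos) (hac : π a c) (hnab : ¬π a b) (hbw : π b w) :
    a.pos < w.pos ∧ w.pos < c.pos := by
  by_contra hw
  rcases lt_trichotomy w.pos a.pos with h | h | h
  · exact hnab (π.symm' (π.trans' hbw (hπ w a b c h hab hbc (π.symm' hbw) hac)))
  · exact hnab (π.symm' ((RowPoint.pos_injective h) ▸ hbw))
  rcases lt_trichotomy w.pos c.pos with h' | h' | h'
  · exact hw ⟨h, h'⟩
  · exact hnab (π.trans' hac (π.symm' ((RowPoint.pos_injective h') ▸ hbw)))
  · exact hnab (hπ a b c w hab hbc h' hac hbw)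

/-- The vertical layer (in particular every detach generator `D_x`) preserves planarity. [folklore] -/
theorem vertRel (hπ : IsNonCrossing π) (O : Finset S) : IsNonCrossing (vertRel O π) := by
  intro a b c d hab hbc hcd hac hbd
  rw [vertRel_apply] at hac hbd ⊢
  rcases hac with hac | ⟨ha, hc, hac⟩
  · subst hac; omega
  rcases hbd with hbd | ⟨hb, hd, hbd⟩
  · subst hbd; omega
  exact Or.inr ⟨ha, hb, hπ a b c d hab hbc hcd hac hbd⟩

/-- The detach generator preserves planarity. [folklore] -/
theorem detachRel (hπ : IsNonCrossing π) (x : S) : IsNonCrossing (detachRel x π) :=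
  hπ.vertRel _

/-- **Merging the classes of two adjacent boundary points keeps a partition non-crossing.**
[folklore] -/
theorem sup_joinTwo (hπ : IsNonCrossing π) (u v : RowPoint S) (huv : v.pos = u.pos + 1) :
    IsNonCrossing (π ⊔ joinTwo u v) := by
  intro a b c d hab hbc hcd hac hbd
  rw [sup_joinTwo_apply] at hac hbd ⊢
  -- `A e`: `e` lies in the merged class
  have hA : ∀ {e e' : RowPoint S}, π e e' → (π e' u ∨ π e' v) → (π e u ∨ π e v) :=
    fun h h' => h'.imp (π.trans' h) (π.trans' h)
  by_contra hgoal
  rw [not_or] at hgoal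
  obtain ⟨hnab, hnAab⟩ := hgoal
  rcases hac with hac | ⟨hAa, hAc⟩ <;> rcases hbd with hbd | ⟨hAb, hAd⟩
  · exact hnab (hπ a b c d hab hbc hcd hac hbd)
  · -- `a ~ c` in `π`, `b` and `d` in the merged class, `a` (hence `c`) not in it
    have hnAa : ¬(π a u ∨ π a v) := fun h => hnAab ⟨h, hAb⟩
    obtain ⟨p, hp, hbp⟩ : ∃ p, (p = u ∨ p = v) ∧ π b p := by
      rcases hAb with h | h
      exacts [⟨u, Or.inl rfl, h⟩, ⟨v, Or.inr rfl, h⟩]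
    obtain ⟨q, hq, hdq⟩ : ∃ q, (q = u ∨ q = v) ∧ π d q := by
      rcases hAd with h | h
      exacts [⟨u, Or.inl rfl, h⟩, ⟨v, Or.inr rfl, h⟩]
    have hp_in := hπ.mem_Ioo_of_rel hab hbc hac hnab hbp
    by_cases hpq : p = q
    · subst hpq
      exact hnab (hπ a b c d hab hbc hcd hac (π.trans' hbp (π.symm' hdq)))
    have hadj : q.pos = p.pos + 1 ∨ p.pos = q.pos + 1 := by
      rcases hp with rfl | rfl <;> rcases hq with rfl | rfl
      · exact absurd rfl hpq
      · exact Or.inl huv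
      · exact Or.inr huv
      · exact absurd rfl hpq
    have hqa : q ≠ a := by
      rintro rfl
      exact hnAa (hq.elim (fun h => Or.inl (h ▸ π.refl _)) (fun h => Or.inr (h ▸ π.refl _)))
    have hqc : q ≠ c := by
      rintro rfl
      exact hnAa (hA hac (hq.elim (fun h => Or.inl (h ▸ π.refl _)) (fun h => Or.inr (h ▸ π.refl _))))
    have hqa' : q.pos ≠ a.pos := fun h => hqa (RowPoint.pos_injective h)
    have hqc' : q.pos ≠ c.pos := fun h => hqc (RowPoint.pos_injective h)
    have haq : a.pos < q.pos := by omega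
    have hqc'' : q.pos < c.pos := by omega
    have := hπ a q c d haq hqc'' hcd hac (π.symm' hdq)
    exact hnAa (hq.elim (fun h => Or.inl (h ▸ this)) (fun h => Or.inr (h ▸ this)))
  · -- `a` and `c` in the merged class, `b ~ d` in `π`, `b` (hence `d`) not in it
    have hnAb : ¬(π b u ∨ π b v) := fun h => hnAab ⟨hAa, h⟩
    have hnbc : ¬π b c := fun h => hnAb (hA h hAc)
    obtain ⟨p, hp, hap⟩ : ∃ p, (p = u ∨ p = v) ∧ π a p := by
      rcases hAa with h | h
      exacts [⟨u, Or.inl rfl, h⟩, ⟨v, Or.inr rfl, h⟩]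
    obtain ⟨q, hq, hcq⟩ : ∃ q, (q = u ∨ q = v) ∧ π c q := by
      rcases hAc with h | h
      exacts [⟨u, Or.inl rfl, h⟩, ⟨v, Or.inr rfl, h⟩]
    by_cases hpq : p = q
    · subst hpq
      exact hnab (hπ a b c d hab hbc hcd (π.trans' hap (π.symm' hcq)) hbd)
    have hq_in := hπ.mem_Ioo_of_rel hbc hcd hbd hnbc hcq
    have hadj : q.pos = p.pos + 1 ∨ p.pos = q.pos + 1 := by
      rcases hp with rfl | rfl <;> rcases hq with rfl | rfl
      · exact absurd rfl hpq
      · exact Or.inl huv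
      · exact Or.inr huv
      · exact absurd rfl hpq
    have hpb : p ≠ b := by
      rintro rfl
      exact hnAb (hp.elim (fun h => Or.inl (h ▸ π.refl _)) (fun h => Or.inr (h ▸ π.refl _)))
    have hpd : p ≠ d := by
      rintro rfl
      exact hnAb (hA hbd (hp.elim (fun h => Or.inl (h ▸ π.refl _)) (fun h => Or.inr (h ▸ π.refl _))))
    have hpb' : p.pos ≠ b.pos := fun h => hpb (RowPoint.pos_injective h)
    have hpd' : p.pos ≠ d.pos := fun h => hpd (RowPoint.pos_injective h)
    have hbp : b.pos < p.pos := by omega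
    have hpd'' : p.pos < d.pos := by omega
    exact hnab (hπ a b p d hab hbp hpd'' hap hbd)
  · exact hnAab ⟨hAa, hAb⟩

/-- **The join generator `J_x` preserves planarity** (`x` and `x + 1` are adjacent on the
boundary). [folklore] -/
theorem joinRel (hπ : IsNonCrossing π) (x : S) : IsNonCrossing (joinRel x π) := by
  by_cases h : (x : ℤ) + 1 ∈ S
  · rw [Literature.Probability.LatticeModels.joinRel, hEdgeRel_of_mem x h]
    exact hπ.sup_joinTwo _ _ rfl
  · rw [joinRel_of_not_mem x h]
    exact hπ

/-- The horizontal layer preserves planarity. [folklore] -/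
theorem horizRel (hπ : IsNonCrossing π) (H : Finset S) : IsNonCrossing (horizRel H π) := by
  induction H using Finset.induction_on with
  | empty => rwa [horizRel_empty]
  | insert x H _ ih =>
    rw [horizRel_insert]
    exact ih.joinRel x

/-- Restriction to a smaller column set preserves planarity. [folklore] -/
theorem restrictRel (h : S ⊆ S') {π' : Setoid (RowPoint S')} (hπ : IsNonCrossing π') :
    IsNonCrossing (restrictRel h π') := by
  have hlt : ∀ a b : RowPoint S, a.pos < b.pos → (RowPoint.incl h a).pos < (RowPoint.incl h b).pos := by
    rintro (x | u) (y | v) hxy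
    · exact hxy
    · exact lt_starPos (h x.2)
    · exact absurd ((lt_starPos y.2).trans hxy) (lt_irrefl _)
    · exact absurd hxy (lt_irrefl _)
  intro a b c d hab hbc hcd hac hbd
  exact hπ _ _ _ _ (hlt a b hab) (hlt b c hbc) (hlt c d hcd) hac hbd

/-- Insertion of singleton columns preserves planarity. [folklore] -/
theorem insertRel (h : S ⊆ S') (hπ : IsNonCrossing π) : IsNonCrossing (insertRel h π) := by
  have hlt : ∀ a b : RowPoint S, (RowPoint.incl h a).pos < (RowPoint.incl h b).pos → a.pos < b.pos := by
    rintro (x | u) (y | v) hxy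
    · exact hxy
    · exact lt_starPos x.2
    · exact absurd ((lt_starPos (h y.2)).trans hxy) (lt_irrefl _)
    · exact absurd hxy (lt_irrefl _)
  intro a b c d hab hbc hcd hac hbd
  rcases hac with hac | ⟨a', c', rfl, rfl, hac⟩
  · subst hac; omega
  rcases hbd with hbd | ⟨b', d', rfl, rfl, hbd⟩
  · subst hbd; omega
  exact Or.inr ⟨a', b', rfl, rfl, hπ a' b' c' d' (hlt _ _ hab) (hlt _ _ hbc) (hlt _ _ hcd) hac hbd⟩

end IsNonCrossing

/-! ### Planar connectivity states and the transfer matrix on them -/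

namespace RowState

/-- **A connectivity state is planar** if its partition of the row points is non-crossing for
the boundary order (columns left to right, then `⋆`). [cite: JacobsenZinnjustin2001, §4] -/
def IsPlanar (π : RowState S) : Prop :=
  IsNonCrossing π.rel

/-- The wired state is planar. [folklore] -/
theorem isPlanar_wired (S : Finset ℤ) : (wired S).IsPlanar :=
  isNonCrossing_top

/-- The free state is planar. [folklore] -/
theorem isPlanar_free (S : Finset ℤ) : (free S).IsPlanar :=
  isNonCrossing_bot

namespace IsPlanar

variable {π : RowState S}

/-- **Row steps preserve planarity**: the planar states span an invariant subspace of the transfer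
matrix. [cite: JacobsenZinnjustin2001, §4] -/
theorem rowStep (hπ : π.IsPlanar) (O H : Finset S) : (rowStep O H π).IsPlanar :=
  (IsNonCrossing.vertRel hπ O).horizRel H

/-- `D_x` preserves planarity. [folklore] -/
theorem detach (hπ : π.IsPlanar) (x : S) : (π.detach x).IsPlanar :=
  IsNonCrossing.detachRel hπ x

/-- `J_x` preserves planarity. [folklore] -/
theorem join (hπ : π.IsPlanar) (x : S) : (π.join x).IsPlanar :=
  IsNonCrossing.joinRel hπ x

/-- Insertion `J_{S,S'}` preserves planarity. [folklore] -/
theorem insertState (h : S ⊆ S') (hπ : π.IsPlanar) : (insertState h π).IsPlanar :=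
  IsNonCrossing.insertRel h hπ

/-- Restriction `J_{S',S}` preserves planarity. [folklore] -/
theorem restrictState (h : S ⊆ S') {π' : RowState S'} (hπ : π'.IsPlanar) :
    (restrictState h π').IsPlanar :=
  IsNonCrossing.restrictRel h hπ

end IsPlanar

end RowState

/-- **The planar state space `V_S`**: planar (non-crossing) connectivity states of the row over
the columns `S`. [cite: JacobsenZinnjustin2001, §4] -/
def PlanarRowState (S : Finset ℤ) : Type :=
  {π : RowState S // π.IsPlanar}

namespace PlanarRowState

/-- `V_S` is finite. [folklore] -/
instance instFintype : Fintype (PlanarRowState S) :=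
  Subtype.fintype _

/-- The wired state as a planar state. [folklore] -/
def wired (S : Finset ℤ) : PlanarRowState S :=
  ⟨RowState.wired S, RowState.isPlanar_wired S⟩

/-- `V_S` is inhabited by the wired state. [folklore] -/
instance : Inhabited (PlanarRowState S) := ⟨wired S⟩

end PlanarRowState

/-- The deterministic row step restricted to planar states. [folklore] -/
def planarRowStep (O H : Finset S) (p : PlanarRowState S) : PlanarRowState S :=
  ⟨rowStep O H p.1, p.2.rowStep O H⟩

/-- From a planar state the transfer matrix only charges planar states. [folklore] -/
theorem isPlanar_of_percolationRowTransfer_ne_zero {π π' : RowState S} (hπ : π.IsPlanar)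
    (h : PercolationRowTransfer S π π' ≠ 0) : π'.IsPlanar := by
  unfold PercolationRowTransfer at h
  rw [Ne, div_eq_zero_iff, not_or, Nat.cast_eq_zero, Finset.card_eq_zero] at h
  obtain ⟨OH, hOH⟩ := Finset.nonempty_iff_ne_empty.2 h.1
  rw [mem_filter] at hOH
  rw [← hOH.2]
  exact hπ.rowStep _ _

/-- **The transfer matrix on the planar state space `V_S`**: the principal submatrix of
`PercolationRowTransfer S` on planar states (to which the dynamics restricts).
[cite: BondesanJacobsenSaleur2012, §5.1] -/
def planarTransfer (S : Finset ℤ) : Matrix (PlanarRowState S) (PlanarRowState S) ℝ :=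
  fun p q => PercolationRowTransfer S p.1 q.1

/-- `planarTransfer` is a submatrix of the full transfer matrix. [folklore] -/
theorem planarTransfer_eq_submatrix (S : Finset ℤ) :
    planarTransfer S = (PercolationRowTransfer S).submatrix Subtype.val Subtype.val :=
  rfl

/-- **The planar transfer matrix is stochastic**: no mass leaves `V_S`. [folklore] -/
theorem sum_planarTransfer_eq_one (S : Finset ℤ) (p : PlanarRowState S) :
    ∑ q, planarTransfer S p q = 1 := by
  unfold planarTransfer
  rw [← sum_percolationRowTransfer_eq_one S p.1,
    ← Finset.sum_filter_of_ne (p := RowState.IsPlanar)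
      (fun π' _ hne => isPlanar_of_percolationRowTransfer_ne_zero p.2 hne)]
  exact (Finset.sum_subtype _ (fun π' => by simp) fun π' => PercolationRowTransfer S p.1 π').symm

/-- The boundary vector `α_S` on `V_S` (Dirac mass at the wired state). [cite: Cardy2001, §7.1] -/
def planarBoundary (S : Finset ℤ) : PlanarRowState S → ℝ :=
  fun p => rowBoundary S p.1

/-- The read-out functional `β_S` on `V_S`. [cite: Cardy2001, §7.1] -/
def planarReadout (S : Finset ℤ) : PlanarRowState S → ℝ :=
  fun p => rowReadout S p.1

/-- `α_S` is a probability vector on `V_S`. [folklore] -/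
theorem sum_planarBoundary (S : Finset ℤ) : ∑ p, planarBoundary S p = 1 := by
  rw [Finset.sum_eq_single (PlanarRowState.wired S)]
  · show (if (PlanarRowState.wired S).1 = RowState.wired S then (1 : ℝ) else 0) = 1
    exact if_pos rfl
  · intro b _ hb
    show (if b.1 = RowState.wired S then (1 : ℝ) else 0) = 0
    exact if_neg fun h => hb (Subtype.ext h)
  · exact fun h => absurd (Finset.mem_univ _) h

end Literature.Probability.LatticeModels

end
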